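import Summits.CriticalPhenomena.PercolationContinuityZ3.Theorems.PercNearOneGluingNoHeavyLowerTailSunflowerAndrasfaiMergingPrelim
import HarnessLib

/-!
# `NoHeavyLowerTail` (crux stmt-CriticalPhenomena-4575), abstract sunflower cubic: the ANDRÁSFAI GRAPHS ARE A-SAFE, part 3b — the Interval Merging Lemma: the injection `Φ`, its decoding, and the inequality `iml`

Support file (seat `prim-ineq-prove-1` gen 42; `--supports stmt-CriticalPhenomena-4575`).  No `sorry`, no named facts, standard axioms.
Memo: run/shared/lean/prim/prim-ineq-prove-1/FINDING-BLOWUP-prove1-g42.md §7 (the theorem and its proof).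

THE PROGRAMME (files `…SunflowerAndrasfai*`).  THEOREM (memo §7; `Arc.arcGraph_safe` in `…SunflowerAndrasfaiSafe`): for every `k`
the graph core of the Andrásfai graph (`arcGraph k` on `Fin (3k+2)`: adjacent iff in no common arc of `k+1` consecutive points) is
safe for every product measure — conjecture (And) of `…SunflowerAndrasfai`; hence (…SunflowerBlowup, …BlowupHom) so is the core
of every blow-up of an Andrásfai graph and of every maximal triangle-free graph homomorphic to one.  PROOF: polarisation
(`safe_arcGraph_of_colouring_ineq`, part 1b) reduces safety to `∏_j Λ(C_j) ≤ Λ(∅)^(K-1)` for colourings of the arc-starts; this is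
proved by induction on the number of colour changes (part 4): one of two adjacent LIGHT runs `X`, `Y` (`|X|+|Y| ≤ 2k+1`, `|Y| ≤ k`,
part 2b) is recoloured with the other's colour, which does not decrease the product by FACT 1/2 (part 2a) and the INTERVAL MERGING
LEMMA `w(X)·w(Y) ≤ Λ(∅)·z(X,Y)` (part 3: an explicit weight-preserving injection `Φ : W_X × W_Y → A × Z_{XY}`).

THIS FILE.  `lowPart`/`highPart`, indicator bookkeeping, the type test `Type1`, **`phi`** (type 1: `(S ∪ T_hi, T_M)`; type 2:
`(S_{≤k-1} ∪ T_hi, T_M ∪ S_{≥k})`) and its left inverse `dec` (`dec_phi`), `phi_mem` (images are a core row and a crossing row, with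
the same membership counts), and **`iml`**: `wset p X · wset p Y ≤ Λ p ∅ · zset p X Y` for adjacent intervals `X`, `Y` of starts with
`|X| + |Y| ≤ 2k+1`, `1 ≤ |Y| ≤ k`.
-/

noncomputable section

namespace Summit.CriticalPhenomena.PercolationContinuityZ3.Theorems.SunflowerPartition

namespace SafeCalc

open Finset
open TwoGenCore (wmiss)

namespace Arc

variable {k : ℕ}

/-! ## The Interval Merging Lemma: the injection `Φ` and the inequality -/

section IML2

variable (p : Fin (3 * k + 2) → unitInterval)

/-- The part of a row with coordinates `≤ m` (from the origin `o`). -/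
def lowPart (o : Fin (3 * k + 2)) (m : ℕ) (S : Finset (Fin (3 * k + 2))) : Finset (Fin (3 * k + 2)) :=
  S.filter fun x => fd o x ≤ m

/-- The part of a row with coordinates `≥ m`. -/
def highPart (o : Fin (3 * k + 2)) (m : ℕ) (S : Finset (Fin (3 * k + 2))) : Finset (Fin (3 * k + 2)) :=
  S.filter fun x => m ≤ fd o x

/-- Membership in the low part. -/
@[simp] theorem mem_lowPart {o : Fin (3 * k + 2)} {m : ℕ} {S : Finset (Fin (3 * k + 2))} {x : Fin (3 * k + 2)} :
    x ∈ lowPart o m S ↔ x ∈ S ∧ fd o x ≤ m := by simp [lowPart]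

/-- Membership in the high part. -/
@[simp] theorem mem_highPart {o : Fin (3 * k + 2)} {m : ℕ} {S : Finset (Fin (3 * k + 2))} {x : Fin (3 * k + 2)} :
    x ∈ highPart o m S ↔ x ∈ S ∧ m ≤ fd o x := by simp [highPart]

/-- Indicator of a disjoint union. -/
theorem ind_union {A B : Finset (Fin (3 * k + 2))} (h : Disjoint A B) (x : Fin (3 * k + 2)) :
    (if x ∈ A ∪ B then (1 : ℕ) else 0) = (if x ∈ A then 1 else 0) + (if x ∈ B then 1 else 0) := by
  by_cases ha : x ∈ A <;> by_cases hb : x ∈ B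
  · exact absurd hb (Finset.disjoint_left.1 h ha)
  · rw [if_pos (mem_union_left _ ha), if_pos ha, if_neg hb]
  · rw [if_pos (mem_union_right _ hb), if_neg ha, if_pos hb]
  · rw [if_neg (by rw [mem_union]; exact not_or.2 ⟨ha, hb⟩), if_neg ha, if_neg hb]

/-- Indicator split of a row into its low and high parts at a threshold. -/
theorem ind_split (o : Fin (3 * k + 2)) (S : Finset (Fin (3 * k + 2))) {m m' : ℕ} (hm : m' = m + 1) (x : Fin (3 * k + 2)) :
    (if x ∈ S then (1 : ℕ) else 0) = (if x ∈ lowPart o m S then 1 else 0) + (if x ∈ highPart o m' S then 1 else 0) := by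
  by_cases hx : x ∈ S
  · rw [if_pos hx]
    by_cases hc : fd o x ≤ m
    · rw [if_pos (mem_lowPart.2 ⟨hx, hc⟩), if_neg (by rw [mem_highPart]; omega)]
    · rw [if_neg (by rw [mem_lowPart]; omega), if_pos (mem_highPart.2 ⟨hx, by omega⟩)]
  · rw [if_neg hx, if_neg (by rw [mem_lowPart]; exact fun h => hx h.1), if_neg (by rw [mem_highPart]; exact fun h => hx h.1)]

/-- Low and high parts at consecutive thresholds are disjoint. -/
theorem disjoint_low_high (o : Fin (3 * k + 2)) (S T : Finset (Fin (3 * k + 2))) {m m' : ℕ} (hm : m < m') :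
    Disjoint (lowPart o m S) (highPart o m' T) := by
  rw [Finset.disjoint_left]; intro x h1 h2; rw [mem_lowPart] at h1; rw [mem_highPart] at h2; omega

/-- TYPE 1 test: the row has a point with coordinate in `[k, s+k-1]`. -/
def Type1 (o : Fin (3 * k + 2)) (s : ℕ) (T : Finset (Fin (3 * k + 2))) : Prop := ∃ x ∈ T, k ≤ fd o x ∧ fd o x ≤ s + k - 1

/-- `Type1` is decidable. -/
instance decType1 (o : Fin (3 * k + 2)) (s : ℕ) : DecidablePred (Type1 (k := k) o s) := fun T =>
  inferInstanceAs (Decidable (∃ x ∈ T, k ≤ fd o x ∧ fd o x ≤ s + k - 1))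

/-- **The injection `Φ`** of the Interval Merging Lemma (memo §7 Step 2): for `(S, T) ∈ W_X × W_Y`,
type 1: `(S ∪ T_hi, T_M)`; type 2: `(S_{≤k-1} ∪ T_hi, T_M ∪ S_{≥k})`, where `T_M = T_{≤ s+k-1}`, `T_hi = T_{≥ s+k}`. [this work] -/
def phi (o : Fin (3 * k + 2)) (s : ℕ) (q : Finset (Fin (3 * k + 2)) × Finset (Fin (3 * k + 2))) :
    Finset (Fin (3 * k + 2)) × Finset (Fin (3 * k + 2)) :=
  if Type1 (k := k) o s q.2 then (q.1 ∪ highPart o (s + k) q.2, lowPart o (s + k - 1) q.2)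
  else (lowPart o (k - 1) q.1 ∪ highPart o (s + k) q.2, lowPart o (s + k - 1) q.2 ∪ highPart o k q.1)

/-- The DECODING map (left inverse of `Φ` on `W_X × W_Y`): the type is read off from `B ∩ [k, s+k-1]`. [this work] -/
def dec (o : Fin (3 * k + 2)) (s : ℕ) (r : Finset (Fin (3 * k + 2)) × Finset (Fin (3 * k + 2))) :
    Finset (Fin (3 * k + 2)) × Finset (Fin (3 * k + 2)) :=
  if Type1 (k := k) o s r.1 then (lowPart o (s + k - 1) r.1, r.2 ∪ highPart o (s + k) r.1)
  else (lowPart o (k - 1) r.1 ∪ highPart o k r.2, lowPart o (k - 1) r.2 ∪ highPart o (s + k) r.1)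

variable {o : Fin (3 * k + 2)} {s t : ℕ}

/-- `dec ∘ Φ = id` on `W_X × W_Y`. [this work] -/
theorem dec_phi (hs1 : 1 ≤ s) (ht1 : 1 ≤ t) (htk : t ≤ k) (hst : s + t ≤ 2 * k + 1)
    {S T : Finset (Fin (3 * k + 2))} (hSU : (U (k := k) S).Nonempty) (hSX : U (k := k) S ⊆ ivl o 0 (s - 1))
    (hTU : (U (k := k) T).Nonempty) (hTY : U (k := k) T ⊆ ivl o s (s + t - 1)) :
    dec (k := k) o s (phi (k := k) o s (S, T)) = (S, T) := by
  obtain ⟨-, hSle, -, -, hSk⟩ := shape_X hs1 (by omega) hSU hSX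
  obtain ⟨-, hTb, -, hTmin, -⟩ := shape_Y hs1 ht1 hst hTU hTY
  unfold phi dec
  by_cases h1 : Type1 (k := k) o s T
  · rw [if_pos h1]
    dsimp only
    have hB : Type1 (k := k) o s (S ∪ highPart o (s + k) T) := by
      obtain ⟨x, hx, hxk⟩ := hSk
      exact ⟨x, mem_union_left _ hx, hxk, hSle x hx⟩
    rw [if_pos hB]
    congr 1
    · ext x; simp only [mem_lowPart, mem_union, mem_highPart]
      constructor
      · rintro ⟨h | ⟨-, h⟩, h'⟩
        · exact h
        · omega
      · intro h; exact ⟨Or.inl h, hSle x h⟩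
    · ext x; simp only [mem_union, mem_lowPart, mem_highPart]
      constructor
      · rintro (⟨h, -⟩ | ⟨h | ⟨h, -⟩, h'⟩)
        · exact h
        · have := hSle x h; omega
        · exact h
      · intro h
        by_cases hc : fd o x ≤ s + k - 1
        · exact Or.inl ⟨h, hc⟩
        · exact Or.inr ⟨Or.inr ⟨h, by omega⟩, by omega⟩
  · rw [if_neg h1]
    dsimp only
    -- in type 2 every point of `T` with coordinate `≤ s+k-1` has coordinate `≤ k-1`
    have hT2 : ∀ x ∈ T, fd o x ≤ s + k - 1 → fd o x ≤ k - 1 := by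
      intro x hx hle; by_contra h; exact h1 ⟨x, hx, by omega, hle⟩
    have hB : ¬ Type1 (k := k) o s (lowPart o (k - 1) S ∪ highPart o (s + k) T) := by
      rintro ⟨x, hx, hk1, hk2⟩
      rw [mem_union, mem_lowPart, mem_highPart] at hx
      rcases hx with ⟨-, h⟩ | ⟨-, h⟩ <;> omega
    rw [if_neg hB]
    congr 1
    · ext x; simp only [mem_union, mem_lowPart, mem_highPart]
      constructor
      · rintro (⟨⟨h, -⟩ | ⟨-, h'⟩, h2⟩ | ⟨⟨h, h'⟩ | ⟨h, -⟩, h2⟩)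
        · exact h
        · omega
        · have := hT2 x h h'; omega
        · exact h
      · intro h
        by_cases hc : fd o x ≤ k - 1
        · exact Or.inl ⟨Or.inl ⟨h, hc⟩, hc⟩
        · exact Or.inr ⟨Or.inr ⟨h, by omega⟩, by omega⟩
    · ext x; simp only [mem_union, mem_lowPart, mem_highPart]
      constructor
      · rintro (⟨⟨h, -⟩ | ⟨h, h'⟩, h2⟩ | ⟨⟨h, h'⟩ | ⟨h, -⟩, h2⟩)
        · exact h
        · omega
        · omega
        · exact h
      · intro h
        by_cases hc : fd o x ≤ s + k - 1
        · exact Or.inl ⟨Or.inl ⟨h, hc⟩, hT2 x h hc⟩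
        · exact Or.inr ⟨Or.inr ⟨h, by omega⟩, by omega⟩

/-- `Φ` maps `W_X × W_Y` into `A × Z_{XY}` and preserves membership counts. [this work] -/
theorem phi_mem (hs1 : 1 ≤ s) (ht1 : 1 ≤ t) (htk : t ≤ k) (hst : s + t ≤ 2 * k + 1)
    {S T : Finset (Fin (3 * k + 2))} (hSU : (U (k := k) S).Nonempty) (hSX : U (k := k) S ⊆ ivl o 0 (s - 1))
    (hTU : (U (k := k) T).Nonempty) (hTY : U (k := k) T ⊆ ivl o s (s + t - 1)) :
    U (k := k) (phi (k := k) o s (S, T)).1 = ∅ ∧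
    (U (k := k) (phi (k := k) o s (S, T)).2 ⊆ ivl o 0 (s - 1) ∪ ivl o s (s + t - 1) ∧
      (U (k := k) (phi (k := k) o s (S, T)).2 ∩ ivl o 0 (s - 1)).Nonempty ∧
      (U (k := k) (phi (k := k) o s (S, T)).2 ∩ ivl o s (s + t - 1)).Nonempty) ∧
    (∀ x, cnt S T x = cnt (phi (k := k) o s (S, T)).1 (phi (k := k) o s (S, T)).2 x) := by
  obtain ⟨hSne, hSle, hSspan, hSmin, hSk⟩ := shape_X hs1 (by omega) hSU hSX
  obtain ⟨hTne, hTb, hTspan, hTmin, hTmax⟩ := shape_Y hs1 ht1 hst hTU hTY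
  obtain ⟨xa, hxa, hxa'⟩ := hSmin
  obtain ⟨xb, hxb, hxb'⟩ := hSk
  obtain ⟨xm, hxm, hxm'⟩ := hTmin
  obtain ⟨xv, hxv, hxv'⟩ := hTmax
  unfold phi
  by_cases h1 : Type1 (k := k) o s T
  · rw [if_pos h1]
    dsimp only
    refine ⟨?_, ?_, ?_⟩
    · refine U_eq_empty_of_witnesses hs1 (mem_union_left _ hxa) hxa' (mem_union_right _ (mem_highPart.2 ⟨hxv, hxv'⟩)) hxv'
        (Or.inl ⟨xb, mem_union_left _ hxb, hxb', ?_⟩)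
      have := hSspan xa hxa xb hxb; omega
    · obtain ⟨x1, hx1, hx1k, hx1s⟩ := h1
      refine mem_Z_of_coords hs1 hst ⟨xm, mem_lowPart.2 ⟨hxm, by omega⟩⟩ (fun x hx => (hTb x (mem_lowPart.1 hx).1).1)
        (fun x hx => (mem_lowPart.1 hx).2) ⟨xm, mem_lowPart.2 ⟨hxm, by omega⟩, hxm'⟩ ⟨x1, mem_lowPart.2 ⟨hx1, hx1s⟩, hx1k⟩
    · intro x
      unfold cnt
      have hdisj : Disjoint S (highPart o (s + k) T) := by
        rw [Finset.disjoint_left]; intro y h1 h2; rw [mem_highPart] at h2; have := hSle y h1; omega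
      rw [ind_union hdisj, ind_split o T (m := s + k - 1) (m' := s + k) (by omega) x]
      ring
  · rw [if_neg h1]
    dsimp only
    have hT2 : ∀ x ∈ T, fd o x ≤ s + k - 1 → fd o x ≤ k - 1 := by
      intro x hx hle; by_contra h; exact h1 ⟨x, hx, by omega, hle⟩
    have hmk : fd o xm ≤ k - 1 := hT2 xm hxm (by omega)
    have hsk : s ≤ k - 1 := le_trans (hTb xm hxm).1 hmk
    refine ⟨?_, ?_, ?_⟩
    · refine U_eq_empty_of_witnesses hs1 (mem_union_left _ (mem_lowPart.2 ⟨hxa, by omega⟩)) hxa'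
        (mem_union_right _ (mem_highPart.2 ⟨hxv, hxv'⟩)) hxv' (Or.inr ?_)
      have := hTspan xm hxm xv hxv; omega
    · refine mem_Z_of_coords hs1 hst ⟨xm, mem_union_left _ (mem_lowPart.2 ⟨hxm, by omega⟩)⟩ ?_ ?_
        ⟨xm, mem_union_left _ (mem_lowPart.2 ⟨hxm, by omega⟩), hxm'⟩
        ⟨xb, mem_union_right _ (mem_highPart.2 ⟨hxb, hxb'⟩), hxb'⟩
      · intro x hx
        rcases mem_union.1 hx with h | h
        · exact (hTb x (mem_lowPart.1 h).1).1
        · have := (mem_highPart.1 h).2; omega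
      · intro x hx
        rcases mem_union.1 hx with h | h
        · exact (mem_lowPart.1 h).2
        · exact hSle x (mem_highPart.1 h).1
    · intro x
      unfold cnt
      have hd1 : Disjoint (lowPart o (k - 1) S) (highPart o (s + k) T) := disjoint_low_high o S T (by omega)
      -- in type 2 the low part of `T` at `s+k-1` is its low part at `k-1`
      have hTM : lowPart o (s + k - 1) T = lowPart o (k - 1) T := by
        ext y; rw [mem_lowPart, mem_lowPart]
        constructor
        · rintro ⟨hy, hc⟩; exact ⟨hy, hT2 y hy hc⟩
        · rintro ⟨hy, hc⟩; exact ⟨hy, by omega⟩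
      have hd2 : Disjoint (lowPart o (s + k - 1) T) (highPart o k S) := by rw [hTM]; exact disjoint_low_high o T S (by omega)
      rw [ind_union hd1, ind_union hd2, ind_split o S (m := k - 1) (m' := k) (by omega) x,
        ind_split o T (m := s + k - 1) (m' := s + k) (by omega) x]
      ring

/-- `Λ p ∅` is the weight of the core rows (empty window). -/
theorem lam_empty_eq : lam p ∅ = ∑ ω ∈ univ.filter (fun ω => U (k := k) ω = ∅), wrow p ω := by
  classical
  unfold lam
  rw [sum_filter]
  refine sum_congr rfl fun ω _ => ?_
  by_cases h : U (k := k) ω = ∅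
  · rw [if_pos h, if_pos, mul_one]
    intro t ht
    have : t ∈ U (k := k) ω := mem_U.2 ht
    rw [h] at this; exact absurd this (notMem_empty _)
  · rw [if_neg h, if_neg, mul_zero]
    intro hall
    apply h
    rw [← Finset.not_nonempty_iff_eq_empty]
    rintro ⟨t, ht⟩
    exact absurd (hall t (mem_U.1 ht)) (notMem_empty _)

/-- Re-indexing a sum along a weight-preserving injection into a larger index set of nonnegative terms. -/
theorem sum_le_sum_of_injOn_wt {α β : Type*} [DecidableEq β] (D : Finset α) (E : Finset β) (f : α → ℝ) (g : β → ℝ)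
    (φ : α → β) (hmaps : ∀ q ∈ D, φ q ∈ E) (hinj : Set.InjOn φ ↑D) (hwt : ∀ q ∈ D, f q = g (φ q))
    (hg : ∀ r ∈ E, 0 ≤ g r) : ∑ q ∈ D, f q ≤ ∑ r ∈ E, g r := by
  rw [sum_congr rfl hwt, ← sum_image hinj]
  exact sum_le_sum_of_subset_of_nonneg (fun r hr => by obtain ⟨q, hq, rfl⟩ := mem_image.1 hr; exact hmaps q hq)
    fun r hr _ => hg r hr

/-- Products of sums compared along a weight-preserving injection of index pairs. -/
theorem mul_sum_le_of_inj {α : Type*} [DecidableEq α] (F1 F2 F3 F4 : Finset α) (w : α → ℝ) (hw : ∀ a, 0 ≤ w a)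
    (φ : α × α → α × α) (hmaps : ∀ q ∈ F1 ×ˢ F2, φ q ∈ F3 ×ˢ F4) (hinj : Set.InjOn φ ↑(F1 ×ˢ F2))
    (hwt : ∀ q ∈ F1 ×ˢ F2, w q.1 * w q.2 = w (φ q).1 * w (φ q).2) :
    (∑ a ∈ F1, w a) * (∑ b ∈ F2, w b) ≤ (∑ a ∈ F3, w a) * (∑ b ∈ F4, w b) := by
  calc (∑ a ∈ F1, w a) * (∑ b ∈ F2, w b) = ∑ q ∈ F1 ×ˢ F2, w q.1 * w q.2 := by rw [sum_mul_sum, sum_product]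
    _ ≤ ∑ r ∈ F3 ×ˢ F4, w r.1 * w r.2 :=
        sum_le_sum_of_injOn_wt _ _ _ _ φ hmaps hinj hwt fun r _ => mul_nonneg (hw _) (hw _)
    _ = (∑ a ∈ F3, w a) * (∑ b ∈ F4, w b) := by rw [sum_mul_sum, sum_product]

/-- **INTERVAL MERGING LEMMA** (memo §7 Step 2).  For adjacent cyclic intervals of starts `X = ivl o 0 (s-1)` and
`Y = ivl o s (s+t-1)` with `1 ≤ s`, `1 ≤ t ≤ k`, `s + t ≤ 2k+1`:
`wset p X · wset p Y ≤ Λ p ∅ · zset p X Y` — the product of the two petal weights is at most the core weight times the crossing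
weight (the double sum over `W_X × W_Y` is re-indexed along the weight-preserving injection `Φ` into `A × Z_{XY}`). [this work] -/
theorem iml (hs1 : 1 ≤ s) (ht1 : 1 ≤ t) (htk : t ≤ k) (hst : s + t ≤ 2 * k + 1) :
    wset p (ivl o 0 (s - 1)) * wset p (ivl o s (s + t - 1)) ≤ lam p ∅ * zset p (ivl o 0 (s - 1)) (ivl o s (s + t - 1)) := by
  unfold wset zset
  rw [lam_empty_eq]
  refine mul_sum_le_of_inj _ _ _ _ (wrow p) (wrow_nonneg p) (phi (k := k) o s) ?_ ?_ ?_
  · intro q hq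
    simp only [mem_product, mem_filter, mem_univ, true_and] at hq ⊢
    obtain ⟨hA, hZ, -⟩ := phi_mem hs1 ht1 htk hst (S := q.1) (T := q.2) hq.1.1 hq.1.2 hq.2.1 hq.2.2
    exact ⟨hA, hZ⟩
  · intro q hq q' hq' heq
    simp only [coe_product, coe_filter, Set.mem_prod, Set.mem_setOf_eq, mem_univ, true_and] at hq hq'
    have e1 := dec_phi hs1 ht1 htk hst (S := q.1) (T := q.2) hq.1.1 hq.1.2 hq.2.1 hq.2.2
    have e2 := dec_phi hs1 ht1 htk hst (S := q'.1) (T := q'.2) hq'.1.1 hq'.1.2 hq'.2.1 hq'.2.2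
    rw [Prod.mk.eta] at e1 e2
    rw [← e1, ← e2, heq]
  · intro q hq
    simp only [mem_product, mem_filter, mem_univ, true_and] at hq
    obtain ⟨-, -, hc⟩ := phi_mem hs1 ht1 htk hst (S := q.1) (T := q.2) hq.1.1 hq.1.2 hq.2.1 hq.2.2
    exact wrow_mul_eq_of_cnt p hc

end IML2

end Arc

end SafeCalc

end Summit.CriticalPhenomena.PercolationContinuityZ3.Theorems.SunflowerPartition
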